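import Summits.ResolutionOfSingularities.ResolutionOfSingularities.Theses.JacobianBudget
import Summits.ResolutionOfSingularities.ResolutionOfSingularities.Theorems.NoPeriodicIsolatedAtom.Negative.FalseWithoutIsol
import Literature.AlgebraicGeometry.Resolution.FormalNormalCrossingsLemmas

/-!
# `IsolatedJacobianDrop` (crux stmt-ResolutionOfSingularities-18946, route `JacobianBudget`):
# the multiplicity hypothesis at the EARLIER stage, `MultP (run m)`, is load-bearing
# (negative-side support from the crux-disprover seat; this file does NOT refute the crux)

The crux: along the point-blow-up dynamics of a height-one atom `z^p = a(u₁,…,uₙ)` over a perfect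
field of characteristic `p`, whenever the states at stages `m` and `m+1` are both ISOLATED (`Isol`:
`κ[[u]] ⧸ (∂a)` finite over `κ`) of MULTIPLICITY `p` (`MultP`: cleaned order `≥ p`), the Jacobian
colength `μ = dim_κ κ[[u]] ⧸ (∂₁a,…,∂ₙa)` drops by at least `Δ_n(p) = ((p-1)^n(p+1) - (-1)^n)/p`.

`crux_iff : IsolatedJacobianDrop ↔ … := Iff.rfl` certifies that the crux's fourteen `let`s are,
definitionally, the mirrored operators `clean bl ord dv tr step run ser pd jac` of
`Theorems/NoPeriodicIsolatedAtom/Negative/FalseWithoutIsol.lean` (the `let`-block is shared verbatim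
by the routes FrobeniusClosing / WildCones / JacobianBudget) with `Isol`, `MultP`, `mu`, `Δ` displayed
inline.  `isolatedJacobianDrop_false_without_MultP` then proves that the right-hand side with the
single hypothesis `MultP (run m)` deleted (everything else verbatim) is FALSE.

Witness `(p, n, κ) = (2, 2, 𝔽₂)`, start `c₀ = x` (the SMOOTH atom `z² = x`), chart `y`, translation
`0`, `m = 0`:
* stage 0: `x` is `2`-clean of order `1 < 2`, so the division exponent `ite (2 ≤ ord) 2 0` is `0` and
  the step is the TOTAL transform: `bl` sends `x ↦ xy`, `dv _ 0` and `tr _ 0` are identities, `xy` is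
  clean — stage 1 is `xy` (the `A₁`-atom `z² = xy`);
* `Isol` at stage 0: `∂x/∂x = 1`, Jacobian ideal `⊤`, Jacobian algebra `0` (finite, `μ = 0`);
* `Isol`, `MultP` at stage 1: `∂(xy) = (y, x)`, so the Jacobian ideal contains the ideal of the
  variables and `κ[[x,y]] ⧸ (y, x)` is spanned by `1` (finite; in fact `μ = 1`); `xy` is clean,
  non-zero, of order `2 ≥ 2`;
* the conclusion would read `μ(xy) + Δ₂(2) ≤ μ(x)`, i.e. `μ(xy) + 1 ≤ 0` — false.

Reading for provers: below multiplicity `p` at the EARLIER stage the typed dynamics does not divide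
by `u_iᵖ`, and the budget `μ` can then INCREASE (`0 → 1` here); `MultP (run m)` is what makes `step`
the controlled transform `a(u_i v, u_i)/u_iᵖ` on which the conservation law
`Σ_{Q ∈ E} μ_Q + Δ_n(p) = μ_P` (line `euler-noether`) operates.  For the record (paper analysis on the
item, not restated in Lean): `Isol (run m)` is load-bearing too (a non-isolated multiplicity-`p` state
can have an isolated multiplicity-`p` successor, e.g. `x²y² + y⁷ ↦ x²y + y⁴` at `p = 3`), whereas
`Isol (run (m+1))` is formally droppable (junk `finrank = 0` and `Δ_n(p) ≤ μ_P`) and `[PerfectField κ]`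
is not used by the conservation-law proof.

No definition and no notation is declared (the two states are written out as lambdas); kernel-only.
-/

noncomputable section

-- single-problem summit: the doubled namespace component `ResolutionOfSingularities` is forced by the tree layout
set_option linter.dupNamespace false

namespace Summit.ResolutionOfSingularities.ResolutionOfSingularities.Theorems.IsolatedJacobianDrop.Negative

open Summit.ResolutionOfSingularities.ResolutionOfSingularities.Theses.JacobianBudget (IsolatedJacobianDrop)
open Summit.ResolutionOfSingularities.ResolutionOfSingularities.Theorems.NoPeriodicIsolatedAtom.Negative
  (clean bl ord dv tr step run ser pd jac)
open scoped BigOperators Classical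

/-! ## The mirror is exact -/

/-- **The mirror is exact**: the route decl `IsolatedJacobianDrop` is, definitionally, the following
proposition over the mirrored operators (its `let`-block ζ-reduces onto the `def`s of
`NoPeriodicIsolatedAtom/Negative/FalseWithoutIsol.lean`; `Isol`, `MultP`, `mu`, `Δ` displayed inline). [folklore] -/
theorem crux_iff :
    IsolatedJacobianDrop ↔
      ∀ p : ℕ, p.Prime → ∀ n : ℕ, 0 < n → ∀ (κ : Type) [Field κ] [CharP κ p] [PerfectField κ]
        (c₀ : (Fin n → ℕ) → κ) (i : ℕ → Fin n) (t : ℕ → Fin n → κ),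
        ∀ m, Module.Finite κ (MvPowerSeries (Fin n) κ ⧸ jac p (run p c₀ i t m)) →
          ((∃ A, clean p (run p c₀ i t m) A ≠ 0) ∧
            ∀ A, clean p (run p c₀ i t m) A ≠ 0 → p ≤ Finset.sum Finset.univ (fun j => A j)) →
          Module.Finite κ (MvPowerSeries (Fin n) κ ⧸ jac p (run p c₀ i t (m + 1))) →
          ((∃ A, clean p (run p c₀ i t (m + 1)) A ≠ 0) ∧
            ∀ A, clean p (run p c₀ i t (m + 1)) A ≠ 0 → p ≤ Finset.sum Finset.univ (fun j => A j)) →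
          Module.finrank κ (MvPowerSeries (Fin n) κ ⧸ jac p (run p c₀ i t (m + 1))) +
              ((p - 1) ^ n * (p + 1) + 1 - 2 * ((n + 1) % 2)) / p ≤
            Module.finrank κ (MvPowerSeries (Fin n) κ ⧸ jac p (run p c₀ i t m)) :=
  Iff.rfl

/-! ## The witness: the smooth atom `z² = x` in the plane over `𝔽₂`, blown up in the `y`-chart -/

-- The two states are written out as lambdas (no definition, no notation):
--   the start `x` (`u₀ = x`, `u₁ = y`):           fun A => if A = ![1, 0] then 1 else 0
--   its total transform in the `y`-chart, `xy`:  fun A => if A = ![1, 1] then 1 else 0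

/-- `x` is supported exactly on the exponent `(1, 0)`. [folklore] -/
lemma x_ne_zero_iff (A : Fin 2 → ℕ) : (fun A : Fin 2 → ℕ => if A = ![1, 0] then (1 : ZMod 2) else 0) A ≠ 0 ↔ A = ![1, 0] := by
  by_cases h : A = ![1, 0] <;> simp [h]

/-- `xy` is supported exactly on the exponent `(1, 1)`. [folklore] -/
lemma xy_ne_zero_iff (A : Fin 2 → ℕ) : (fun A : Fin 2 → ℕ => if A = ![1, 1] then (1 : ZMod 2) else 0) A ≠ 0 ↔ A = ![1, 1] := by
  by_cases h : A = ![1, 1] <;> simp [h]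

/-- `x` is `2`-clean (the exponent of `x` is odd). [folklore] -/
lemma clean_x : clean 2 (fun A : Fin 2 → ℕ => if A = ![1, 0] then (1 : ZMod 2) else 0) = (fun A : Fin 2 → ℕ => if A = ![1, 0] then (1 : ZMod 2) else 0) := by
  funext A
  unfold clean
  by_cases h : ∀ j, 2 ∣ A j
  · rw [if_pos h]
    by_cases hA : A = ![1, 0]
    · exact absurd (h 0) (by simp [hA])
    · rw [if_neg hA]
  · rw [if_neg h]

/-- `xy` is `2`-clean (both exponents are odd). [folklore] -/
lemma clean_xy : clean 2 (fun A : Fin 2 → ℕ => if A = ![1, 1] then (1 : ZMod 2) else 0) = (fun A : Fin 2 → ℕ => if A = ![1, 1] then (1 : ZMod 2) else 0) := by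
  funext A
  unfold clean
  by_cases h : ∀ j, 2 ∣ A j
  · rw [if_pos h]
    by_cases hA : A = ![1, 1]
    · exact absurd (h 0) (by simp [hA])
    · rw [if_neg hA]
  · rw [if_neg h]

/-- The order of `x` is `1`. [folklore] -/
lemma ord_x : ord (fun A : Fin 2 → ℕ => if A = ![1, 0] then (1 : ZMod 2) else 0) = 1 := by
  unfold ord
  have hset : {m : ℕ | ∃ A, (fun A : Fin 2 → ℕ => if A = ![1, 0] then (1 : ZMod 2) else 0) A ≠ 0 ∧ m = Finset.sum Finset.univ (fun j => A j)} = {1} := by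
    ext m
    simp only [Set.mem_setOf_eq, Set.mem_singleton_iff, x_ne_zero_iff]
    constructor
    · rintro ⟨A, rfl, rfl⟩
      simp [Fin.sum_univ_two]
    · rintro rfl
      exact ⟨![1, 0], rfl, by simp [Fin.sum_univ_two]⟩
  rw [hset, csInf_singleton]

/-- Blowing up in the `y`-chart (`x ↦ xy`) sends `x` to `xy`. [folklore] -/
lemma bl_x : bl 1 (fun A : Fin 2 → ℕ => if A = ![1, 0] then (1 : ZMod 2) else 0) = (fun A : Fin 2 → ℕ => if A = ![1, 1] then (1 : ZMod 2) else 0) := by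
  funext B
  unfold bl
  have hsum : Finset.sum (Finset.univ.erase (1 : Fin 2)) (fun j => B j) = B 0 := by
    have : (Finset.univ.erase (1 : Fin 2)) = {0} := by decide
    rw [this, Finset.sum_singleton]
  rw [hsum]
  beta_reduce
  by_cases hle : B 0 ≤ B 1
  · rw [if_pos hle]
    have key : (Function.update B 1 (B 1 - B 0) = ![1, 0]) ↔ B = ![1, 1] := by
      constructor
      · intro h
        have h0 := congrFun h 0
        have h1 := congrFun h 1
        simp [Function.update] at h0 h1
        funext j
        fin_cases j <;> simp <;> omega
      · intro h
        subst h
        funext j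
        fin_cases j <;> simp [Function.update]
    by_cases hB : B = ![1, 1]
    · rw [if_pos (key.mpr hB), if_pos hB]
    · rw [if_neg (fun h => hB (key.mp h)), if_neg hB]
  · rw [if_neg hle]
    have hB : B ≠ ![1, 1] := by
      intro h; subst h; simp at hle
    rw [if_neg hB]

/-- Dividing by `u_i ^ 0` is the identity. [folklore] -/
lemma dv_zero {n : ℕ} {κ : Type} [Field κ] (i : Fin n) (c : (Fin n → ℕ) → κ) : dv i 0 c = c := by
  funext B
  unfold dv
  simp

/-- Translating by `τ = 0` is the identity (only `D = 0` contributes: any other `D` with `D i = 0`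
has a coordinate `j ≠ i` with `D j ≠ 0`, and `0 ^ (D j) = 0`). [folklore] -/
lemma tr_zero {n : ℕ} {κ : Type} [Field κ] (i : Fin n) (s : ℕ) (c : (Fin n → ℕ) → κ) :
    tr i (0 : Fin n → κ) s c = c := by
  funext B
  unfold tr
  rw [Finset.sum_eq_single (0 : Fin n → ℕ)]
  · have hprod : Finset.prod (Finset.univ.erase i)
        (fun j => ((Nat.choose (B j + (0 : Fin n → ℕ) j) (B j) : ℕ) : κ) * (0 : Fin n → κ) j ^ ((0 : Fin n → ℕ) j)) = 1 := by
      apply Finset.prod_eq_one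
      intro j _
      simp
    rw [if_pos (show (0 : Fin n → ℕ) i = 0 from rfl), hprod, mul_one, add_zero]
  · intro D _ hD
    by_cases hDi : D i = 0
    · rw [if_pos hDi]
      have hj : ∃ j, j ≠ i ∧ D j ≠ 0 := by
        by_contra hcon
        push Not at hcon
        apply hD
        funext j
        by_cases hji : j = i
        · subst hji; exact hDi
        · exact hcon j hji
      obtain ⟨j, hji, hDj⟩ := hj
      have : Finset.prod (Finset.univ.erase i)
          (fun j => ((Nat.choose (B j + D j) (B j) : ℕ) : κ) * (0 : Fin n → κ) j ^ (D j)) = 0 := by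
        apply Finset.prod_eq_zero (i := j) (Finset.mem_erase.mpr ⟨hji, Finset.mem_univ _⟩)
        simp [zero_pow hDj]
      rw [this, mul_zero]
    · rw [if_neg hDi]
  · intro h
    exact absurd (by simp [Fintype.mem_piFinset]) h

/-- **The step**: at cleaned order `1 < 2` nothing is divided; one step (chart `y`, translation `0`)
maps `x` to its total transform `xy`. [folklore] -/
lemma step_x : step 2 1 (0 : Fin 2 → ZMod 2) (fun A : Fin 2 → ℕ => if A = ![1, 0] then (1 : ZMod 2) else 0) = (fun A : Fin 2 → ℕ => if A = ![1, 1] then (1 : ZMod 2) else 0) := by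
  unfold step
  rw [clean_x, ord_x, if_neg (by norm_num : ¬ (2 ≤ 1)), bl_x, dv_zero, tr_zero, clean_xy]

/-- Stage `1` of the run from `x` along the constant chart `y` and zero translations is `xy`. [folklore] -/
lemma run_one : run 2 (fun A : Fin 2 → ℕ => if A = ![1, 0] then (1 : ZMod 2) else 0) (fun _ => 1) (fun _ _ => 0) 1 = (fun A : Fin 2 → ℕ => if A = ![1, 1] then (1 : ZMod 2) else 0) := by
  show step 2 1 (0 : Fin 2 → ZMod 2) (fun A : Fin 2 → ℕ => if A = ![1, 0] then (1 : ZMod 2) else 0) = (fun A : Fin 2 → ℕ => if A = ![1, 1] then (1 : ZMod 2) else 0)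
  exact step_x

/-! ## Jacobian algebras of the two stages -/

/-- `∂x/∂x = 1` as a formal power series. [folklore] -/
lemma pd_zero_ser_x : pd 0 (ser 2 (fun A : Fin 2 → ℕ => if A = ![1, 0] then (1 : ZMod 2) else 0)) = 1 := by
  refine MvPowerSeries.ext fun A => ?_
  rw [MvPowerSeries.coeff_one]
  change ((A 0 + 1 : ℕ) : ZMod 2) * clean 2 (fun A : Fin 2 → ℕ => if A = ![1, 0] then (1 : ZMod 2) else 0) ((A + Finsupp.single (0 : Fin 2) 1 : Fin 2 →₀ ℕ) : Fin 2 → ℕ) = _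
  rw [clean_x]
  beta_reduce
  have key : (((A + Finsupp.single (0 : Fin 2) 1 : Fin 2 →₀ ℕ) : Fin 2 → ℕ) = ![1, 0]) ↔ A = 0 := by
    constructor
    · intro h
      have h0 := congrFun h 0
      have h1 := congrFun h 1
      simp at h0 h1
      refine Finsupp.ext fun j => ?_
      fin_cases j
      · simpa using h0
      · simpa using h1
    · rintro rfl
      funext j
      fin_cases j <;> simp
  by_cases hA : A = 0
  · rw [if_pos (key.mpr hA), if_pos hA, hA]
    simp
  · rw [if_neg (fun h => hA (key.mp h)), if_neg hA, mul_zero]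

/-- The Jacobian ideal of `x` is the unit ideal. [folklore] -/
lemma jac_x : jac 2 (fun A : Fin 2 → ℕ => if A = ![1, 0] then (1 : ZMod 2) else 0) = ⊤ := by
  unfold jac
  rw [Ideal.eq_top_iff_one]
  exact Ideal.subset_span ⟨0, pd_zero_ser_x⟩

/-- `x` is ISOLATED: its Jacobian algebra `κ[[x,y]] ⧸ (1) = 0` is finite over `κ`. [folklore] -/
lemma isol_x : Module.Finite (ZMod 2) (MvPowerSeries (Fin 2) (ZMod 2) ⧸ jac 2 (fun A : Fin 2 → ℕ => if A = ![1, 0] then (1 : ZMod 2) else 0)) := by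
  rw [jac_x]
  haveI : Subsingleton (MvPowerSeries (Fin 2) (ZMod 2) ⧸ (⊤ : Ideal (MvPowerSeries (Fin 2) (ZMod 2)))) :=
    Ideal.Quotient.subsingleton_iff.mpr rfl
  exact Module.Finite.of_finite

/-- … and `μ(x) = 0`. [folklore] -/
lemma finrank_x : Module.finrank (ZMod 2) (MvPowerSeries (Fin 2) (ZMod 2) ⧸ jac 2 (fun A : Fin 2 → ℕ => if A = ![1, 0] then (1 : ZMod 2) else 0)) = 0 := by
  rw [jac_x]
  haveI : Subsingleton (MvPowerSeries (Fin 2) (ZMod 2) ⧸ (⊤ : Ideal (MvPowerSeries (Fin 2) (ZMod 2)))) :=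
    Ideal.Quotient.subsingleton_iff.mpr rfl
  exact Module.finrank_zero_of_subsingleton

/-- `∂(xy)/∂x = y`. [folklore] -/
lemma pd_zero_ser_xy : pd 0 (ser 2 (fun A : Fin 2 → ℕ => if A = ![1, 1] then (1 : ZMod 2) else 0)) = MvPowerSeries.X 1 := by
  refine MvPowerSeries.ext fun A => ?_
  rw [MvPowerSeries.coeff_X]
  change ((A 0 + 1 : ℕ) : ZMod 2) * clean 2 (fun A : Fin 2 → ℕ => if A = ![1, 1] then (1 : ZMod 2) else 0) ((A + Finsupp.single (0 : Fin 2) 1 : Fin 2 →₀ ℕ) : Fin 2 → ℕ) = _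
  rw [clean_xy]
  beta_reduce
  have key : (((A + Finsupp.single (0 : Fin 2) 1 : Fin 2 →₀ ℕ) : Fin 2 → ℕ) = ![1, 1]) ↔
      A = Finsupp.single 1 1 := by
    constructor
    · intro h
      have h0 := congrFun h 0
      have h1 := congrFun h 1
      simp at h0 h1
      refine Finsupp.ext fun j => ?_
      fin_cases j
      · simpa using h0
      · simpa using h1
    · rintro rfl
      funext j
      fin_cases j <;> simp
  by_cases hA : A = Finsupp.single 1 1
  · rw [if_pos (key.mpr hA), if_pos hA, hA]
    simp
  · rw [if_neg (fun h => hA (key.mp h)), if_neg hA, mul_zero]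

/-- `∂(xy)/∂y = x`. [folklore] -/
lemma pd_one_ser_xy : pd 1 (ser 2 (fun A : Fin 2 → ℕ => if A = ![1, 1] then (1 : ZMod 2) else 0)) = MvPowerSeries.X 0 := by
  refine MvPowerSeries.ext fun A => ?_
  rw [MvPowerSeries.coeff_X]
  change ((A 1 + 1 : ℕ) : ZMod 2) * clean 2 (fun A : Fin 2 → ℕ => if A = ![1, 1] then (1 : ZMod 2) else 0) ((A + Finsupp.single (1 : Fin 2) 1 : Fin 2 →₀ ℕ) : Fin 2 → ℕ) = _
  rw [clean_xy]
  beta_reduce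
  have key : (((A + Finsupp.single (1 : Fin 2) 1 : Fin 2 →₀ ℕ) : Fin 2 → ℕ) = ![1, 1]) ↔
      A = Finsupp.single 0 1 := by
    constructor
    · intro h
      have h0 := congrFun h 0
      have h1 := congrFun h 1
      simp at h0 h1
      refine Finsupp.ext fun j => ?_
      fin_cases j
      · simpa using h0
      · simpa using h1
    · rintro rfl
      funext j
      fin_cases j <;> simp
  by_cases hA : A = Finsupp.single 0 1
  · rw [if_pos (key.mpr hA), if_pos hA, hA]
    simp
  · rw [if_neg (fun h => hA (key.mp h)), if_neg hA, mul_zero]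

/-- The Jacobian ideal of `xy` contains the ideal of the variables. [folklore] -/
lemma span_X_le_jac_xy :
    Ideal.span (Set.range (MvPowerSeries.X : Fin 2 → MvPowerSeries (Fin 2) (ZMod 2))) ≤ jac 2 (fun A : Fin 2 → ℕ => if A = ![1, 1] then (1 : ZMod 2) else 0) := by
  rw [Ideal.span_le]
  rintro _ ⟨s, rfl⟩
  unfold jac
  fin_cases s
  · exact Ideal.subset_span ⟨1, pd_one_ser_xy⟩
  · exact Ideal.subset_span ⟨0, pd_zero_ser_xy⟩

/-- A quotient of `κ[[u₁,…,uₙ]]` by an ideal containing the variables is spanned by `1` over `κ`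
(every series is its constant term modulo the variables,
`MvPowerSeries.mem_span_range_X_of_constantCoeff_eq_zero`), hence finite. [folklore] -/
lemma finite_quot_of_span_X_le {n : ℕ} {κ : Type} [Field κ] (J : Ideal (MvPowerSeries (Fin n) κ))
    (hJ : Ideal.span (Set.range (MvPowerSeries.X : Fin n → MvPowerSeries (Fin n) κ)) ≤ J) :
    Module.Finite κ (MvPowerSeries (Fin n) κ ⧸ J) := by
  refine Module.Finite.of_surjective (Algebra.linearMap κ (MvPowerSeries (Fin n) κ ⧸ J)) ?_
  intro q
  obtain ⟨f, rfl⟩ := Ideal.Quotient.mk_surjective q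
  refine ⟨MvPowerSeries.constantCoeff f, ?_⟩
  rw [Algebra.linearMap_apply, ← Ideal.Quotient.mk_algebraMap, ← MvPowerSeries.c_eq_algebraMap,
    Ideal.Quotient.eq]
  have h0 : MvPowerSeries.constantCoeff (MvPowerSeries.C (MvPowerSeries.constantCoeff f) - f) = 0 := by
    simp
  exact hJ (Literature.AlgebraicGeometry.Resolution.MvPowerSeries.mem_span_range_X_of_constantCoeff_eq_zero h0)

/-- `xy` is ISOLATED: `κ[[x,y]] ⧸ (y, x)` is finite over `κ` (spanned by `1`; `μ = 1`). [folklore] -/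
lemma isol_xy : Module.Finite (ZMod 2) (MvPowerSeries (Fin 2) (ZMod 2) ⧸ jac 2 (fun A : Fin 2 → ℕ => if A = ![1, 1] then (1 : ZMod 2) else 0)) :=
  finite_quot_of_span_X_le _ span_X_le_jac_xy

/-- `xy` has multiplicity `2` (clean, non-zero, every monomial of degree `≥ 2`). [folklore] -/
lemma multP_xy :
    (∃ A, clean 2 (fun A : Fin 2 → ℕ => if A = ![1, 1] then (1 : ZMod 2) else 0) A ≠ 0) ∧ ∀ A, clean 2 (fun A : Fin 2 → ℕ => if A = ![1, 1] then (1 : ZMod 2) else 0) A ≠ 0 → 2 ≤ Finset.sum Finset.univ (fun j => A j) := by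
  rw [clean_xy]
  refine ⟨⟨![1, 1], by simp⟩, ?_⟩
  intro A hA
  rw [xy_ne_zero_iff] at hA
  subst hA
  simp [Fin.sum_univ_two]

/-! ## The load-bearing lemma -/

/-- **`MultP (run m)` is load-bearing in `IsolatedJacobianDrop`.** The proposition below is the
right-hand side of `crux_iff` with the single hypothesis
`(∃ A, clean p (run p c₀ i t m) A ≠ 0) ∧ ∀ A, clean p (run p c₀ i t m) A ≠ 0 → p ≤ |A|` (multiplicity
`p` at the EARLIER stage) deleted and nothing else changed; it is false at
`(p, n, κ, c₀, i, t, m) = (2, 2, 𝔽₂, x, y-chart, 0, 0)`: the smooth atom `z² = x` (isolated, `μ = 0`,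
order `1 < 2`) is not divided and becomes its total transform `z² = xy` (isolated, multiplicity `2`,
`μ = 1`), and `1 + Δ₂(2) = 2 ≰ 0`.  Any proof of the crux must use `MultP (run m)`. [folklore] -/
theorem isolatedJacobianDrop_false_without_MultP :
    ¬ ∀ p : ℕ, p.Prime → ∀ n : ℕ, 0 < n → ∀ (κ : Type) [Field κ] [CharP κ p] [PerfectField κ]
        (c₀ : (Fin n → ℕ) → κ) (i : ℕ → Fin n) (t : ℕ → Fin n → κ),
        ∀ m, Module.Finite κ (MvPowerSeries (Fin n) κ ⧸ jac p (run p c₀ i t m)) →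
          Module.Finite κ (MvPowerSeries (Fin n) κ ⧸ jac p (run p c₀ i t (m + 1))) →
          ((∃ A, clean p (run p c₀ i t (m + 1)) A ≠ 0) ∧
            ∀ A, clean p (run p c₀ i t (m + 1)) A ≠ 0 → p ≤ Finset.sum Finset.univ (fun j => A j)) →
          Module.finrank κ (MvPowerSeries (Fin n) κ ⧸ jac p (run p c₀ i t (m + 1))) +
              ((p - 1) ^ n * (p + 1) + 1 - 2 * ((n + 1) % 2)) / p ≤
            Module.finrank κ (MvPowerSeries (Fin n) κ ⧸ jac p (run p c₀ i t m)) := by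
  intro h
  haveI : PerfectField (ZMod 2) := PerfectField.ofFinite
  have key := h 2 Nat.prime_two 2 two_pos (ZMod 2) (fun A : Fin 2 → ℕ => if A = ![1, 0] then (1 : ZMod 2) else 0) (fun _ => 1) (fun _ _ => 0) 0 isol_x
    (by rw [run_one]; exact isol_xy) (by rw [run_one]; exact multP_xy)
  rw [run_one] at key
  have h0 : Module.finrank (ZMod 2) (MvPowerSeries (Fin 2) (ZMod 2) ⧸ jac 2 (run 2 (fun A : Fin 2 → ℕ => if A = ![1, 0] then (1 : ZMod 2) else 0) (fun _ => 1) (fun _ _ => 0) 0)) = 0 :=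
    finrank_x
  rw [h0] at key
  norm_num at key

end Summit.ResolutionOfSingularities.ResolutionOfSingularities.Theorems.IsolatedJacobianDrop.Negative

end
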